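import Summits.ValiantsHypothesis.ValiantsHypothesis.Theses.LacunarySymmetroid
import Summits.ValiantsHypothesis.ValiantsHypothesis.Theorems.LacunarySymmetroidMatrixDescartesRangeLaw
import Summits.ValiantsHypothesis.ValiantsHypothesis.Theorems.LacunarySymmetroidMatrixDescartesProfileLaw
import Summits.ValiantsHypothesis.ValiantsHypothesis.Theorems.LacunarySymmetroidMatrixDescartesRangeObligations
import Literature.Algebra.Polynomial.ErdosTuranPositiveZerosProofs
import Literature.Algebra.Polynomial.ErdosTuranPositiveZerosHolds
import Summits.ValiantsHypothesis.ValiantsHypothesis.Theorems.LacunarySymmetroidMatrixDescartesRangeObligationsUnconditional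

/-!
# `MatrixDescartes` — line «range» (val-idea-6 g4; lens «control» + «assume the law fails»)

LINE (D-0145) on crux `Summit.ValiantsHypothesis.ValiantsHypothesis.Theses.LacunarySymmetroid.MatrixDescartes`
(stmt-ValiantsHypothesis-18050); bears on the format-level law (`KPlusLogSqLaw`, Conjecture B) through the FULL /
STAMP formats of the census (`Lines/stamp.lean`, `Lines/finite.lean`).  rc 0, **zero sorries**: every open
obligation is a typed `def … : Prop`, every composition is kernel-checked.

STATUS rev 2 (2026-08-28, REWIRED to the tree — val-port-4 g1 for the val-lit merged desk g11, RULING #233 (b); line content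
UNCHANGED).  After val-idea-crit-2 VERDICT #26 = PASS (structure + instrument tier) the line was ported to `Theorems/` BY NAME:
(D) `…LacunarySymmetroidMatrixDescartesFiniteSectorHeightDefs` (p606753, val-port-2: `HeightStampLawAt`, `pencilZ`, `castZ`,
`HeightMatrixDescartes`, `HeightMDRNonFull`, `Rrep`, `ProfileRow`, `l1`, over `…FiniteSectorDefs`' `pencil` / `IsFullPosRooted`),
(R) `…LacunarySymmetroidMatrixDescartesRangeLaw` (p607255, val-port-2: §1–§8, namespace `…Theorems.LacunarySymmetroidMatrixDescartes.Range`),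
(P) `…LacunarySymmetroidMatrixDescartesProfileLaw` (p607420, val-port-1: the companion line «profile»), (§9)
`…LacunarySymmetroidMatrixDescartesRangeObligations` (p607620, val-port-4: `DetL1Bound` PROVED as `RangeObligations.detL1Bound`,
`violator_degree` with that hypothesis discharged).  This file now IMPORTS them: the §0 re-declarations (`pencil`, `IsFullPosRooted`,
and the unused `StampLawAt` / `FullyRealisable`) and the local copies of `HeightStampLawAt` / `pencilZ` / `castZ` / `HeightMatrixDescartes` /
`HeightMDRNonFull` / `l1` are GONE (the names resolve to the tree's `…FiniteSector` declarations, same bodies); every theorem keeps its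
signature token-for-token and its body is the by-name term; `heightMDR_of_matrixDescartes` keeps its local proof (it needs the Theses
import, which `Theorems/` helper files avoid); `DetL1Bound` is now discharged in this file (`detL1Bound`), so `violator_degree` drops the
hypothesis `hL1` (rev 1 signature `(hET : ErdosTuranPositiveAxis) (hL1 : DetL1Bound) …`); `ErdosTuranPositiveAxis` stays a typed OPEN
obligation here until the Literature fact lands (val-lit-p9, desk #233 (d)).  No `stub_*` exists in this line; sorries 0.

STATUS rev 3 (2026-08-28, val-port-4 g1, desk RULING #250 (a)): the Literature fact HAS landed — `Literature.Algebra.Polynomial.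
ErdosTuran1950_positiveZeros` (val-lit-p9 g0, p609585; Erdős–Turán 1950 via Milovanović–Rassias 2000 Thm 5.1, typed, NOT proved) with the
PROVED bridge `ErdosTuran1950_positiveZeros.positiveAxis` (`…ErdosTuranPositiveZerosProofs`) = this line's `ErdosTuranPositiveAxis` token for
token (`l1` unfolded).  New here: `erdosTuranPositiveAxis_of : ErdosTuran1950_positiveZeros → ErdosTuranPositiveAxis` and the composition
`violator_degree_of_erdosTuran1950`; so the line's §9 now rests on ONE NAMED published fact and nothing else (Theorems side:
`…RangeObligationsErdosTuran`).  Sorries 0.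

## Control quantity
The coefficient DYNAMIC RANGE of `q = det P`:  `R(q) := ‖q‖₁ / √|c₀(q)·lc(q)|`, read through the evaluation
`|q(−1)|`.  **Range law** (`rangeLaw_fullPos`, proved, sharp at `c·(X−1)^n`): a real polynomial whose `natDegree`
is spent entirely on distinct positive roots satisfies `2^{deg q} ≤ |q(−1)|/√|c₀·lc| ≤ R(q)` — ONE BIT OF RANGE PER
ROOT.  For a pencil `P = Σ_l X^{d_l} S_l` with letters `|S_l i j| ≤ h`:  `|det P(−1)| = |det Σ(−1)^{d_l}S_l| ≤ m!(Kh)^m`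
(`heightLaw`, proved; symmetry unused), so full-positive-rooted pencils obey `2^n·√|c₀·lc| ≤ m!(Kh)^m`.

## What it decides (all PROVED here)
* `heightStampLaw_G6/G7/G8/G9/2_5` + `natDegree_le_of_int`: the height-`H` rows of the stamp census —
  an INTEGER full `2×2` pencil realising the stamp numbers `16 / 20 / 26 / 32` (`G6–G9` of «stamp») has an entry
  `≥ 31 / 104 / 725 / 5149`; the located `ν(2,5)=12` format needs an entry `≥ 10`.  (INSTRUMENT row for
  `val-sym-engine-7`'s STAMP-G6G8 job: integer/lattice searches below these heights are provably empty; float searches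
  must report `log₂ R(det P) ≥ n`.)
* `heightMDR_fullSector`: in the crux's own regime (`m ≤ 2^{(log K+c)^c}`, `K ≥ K₀`), every full-positive-rooted pencil
  with letters of quasi-polynomial height `≤ 2^{(log K+c)^c}` and `|c₀·lc| ≥ 1` satisfies the crux's rate
  `Z^q ≤ 2^{K log K}` — the FULL SECTOR of the rung below is a theorem.
* `heightMDR_of_matrixDescartes` (on-path) and `heightMDR_of_nonFull` (split): the rung `HeightMatrixDescartes`
  (= the crux at quasi-polynomial height with integer-like ends `|trailing·leading| ≥ 1`; this is the height regime
  of constant-free symmetric representations, whose letters are small integers once denominators are cleared) is implied by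
  the crux and REDUCES to its non-full sector `HeightMDRNonFull` («MDR below theta range», crux-hard by the padding remark of
  VERDICT #26: `S_l ⊕ 2^P·I_r`).
* `violator_degree` («assume the law fails»): under the typed known theorem `ErdosTuranPositiveAxis`
  [Erdős–Turán 1950, doi:10.2307/1969500, Thm 1; Erdélyi 2008, doi:10.1016/j.crma.2008.01.020] (and the routine
  `DetL1Bound`, now PROVED), a violator of the crux's rate at height `h` has `deg(det P) ≥ Z₊²/(256·log(m!(Kh)^m))` — at
  quasi-polynomial height a super-polynomial root count forces DOUBLY-EXPONENTIAL degree waste: violators are the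
  opposite of the census's stamp/full formats, and a VNP-hard family projected constant-free into the format would
  have to be such a degree-inefficient, non-full monster (or carry constants of height `2^{2^{Ω(K log K)}}`, the theta
  regime of `Lines/finite`).

## Honest framing
The lever is HEIGHT-SENSITIVE and `MatrixDescartes` is height-free: real letters of unbounded dynamic range are exactly
where the full formats live (theta: height `2^{2B^{2n}}`), so this line does NOT close the crux and does not touch
Conjecture B at `m = 2` (Descartes-trivial there).  It (i) closes the full sector of the constant-free-height rung,
(ii) prices every integer certificate the census can produce, (iii) types the violator structure.  VP ≠ VNP is not
moved by any of this.

## Why novel (problem-relative)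
Nearest in programme: `Cruxes/WeakLifting/Ideas/conditioning.md` (val-idea-1 g3) prices OCTAVES of a `(w,t)` family by
the letters' log-condition (`normEra_octaveBound`, crux 19561).  Delta: here the DETERMINANT's coefficient range
prices the ROOT COUNT of full pencils directly (one root per bit, sharp constant), on crux 18050 / the B⁻ census
side, with the qp-height full sector of the crux proved and the violator structure typed.  None of the 22
`MatrixDescartes` cards nor lines «octave/hyperbolic/amplify/finite/stamp» uses letter height.  Literature: the range
law is AM–GM folklore (Schur–Siegel trace-problem circle); the degree-waste statement is Erdős–Turán 1950 /
Borwein–Erdélyi–Kós 1999 (doi:10.1112/s0024611599011831) read on pencils.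

## Cheapest falsifier
Everything load-bearing is proved; the falsifiable predictions are the INSTRUMENT rows: an integer full `(2,6)` pencil
of degree `16` with all entries in `[−30,30]`, or the located full `(2,5)` degree-`12` witness rescaled to integer
entries `≤ 9`, would contradict `heightStampLaw_G6` / `heightStampLaw_2_5` (impossible — they are theorems; a reported
one is a bug in the instrument).  The open obligation `HeightMDRNonFull` dies with the crux (any MDR refutation at
qp height is non-full by `heightMDR_fullSector`).
-/

set_option linter.dupNamespace false

noncomputable section

namespace Summit.ValiantsHypothesis.ValiantsHypothesis.Theses.LacunarySymmetroid.RangeLine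

open scoped BigOperators Matrix
open Polynomial
/-! ## §0 Defs — rev 2: none re-declared.  The nine rev-1 names (`pencil`, `IsFullPosRooted`, `StampLawAt`, `FullyRealisable`,
`HeightStampLawAt`, `pencilZ`, `castZ`, `HeightMatrixDescartes`, `HeightMDRNonFull`) and §9's `l1` are RE-EXPORTED from the tree's
`…Theorems.LacunarySymmetroidMatrixDescartes.FiniteSector` (…FiniteSectorDefs / …FiniteSectorHeightDefs p606753; texts identical to
rev 1's local copies), so `RangeLine.pencil`, `RangeLine.HeightMatrixDescartes`, … still resolve for any `open RangeLine` user
(re-export idea: val-port-2 g0's staging 408bb34b8c3e19d0). -/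

export Summit.ValiantsHypothesis.ValiantsHypothesis.Theorems.LacunarySymmetroidMatrixDescartes.FiniteSector
  (pencil IsFullPosRooted StampLawAt FullyRealisable HeightStampLawAt pencilZ castZ HeightMatrixDescartes HeightMDRNonFull l1)

/-- rev-2 probe: the re-exported names are the tree's declarations (by `rfl`). -/
example : @RangeLine.pencil = @Summit.ValiantsHypothesis.ValiantsHypothesis.Theorems.LacunarySymmetroidMatrixDescartes.FiniteSector.pencil ∧
    RangeLine.HeightMatrixDescartes = Summit.ValiantsHypothesis.ValiantsHypothesis.Theorems.LacunarySymmetroidMatrixDescartes.FiniteSector.HeightMatrixDescartes :=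
  ⟨rfl, rfl⟩

/-! ## §1 Root bookkeeping for full-positive-rooted polynomials (PROVED — tree: `…RangeLaw`, namespace `…Range`) -/

theorem card_roots_of_fullPos {q : ℝ[X]} (h : IsFullPosRooted q) :
    Multiset.card q.roots = q.natDegree :=
  Theorems.LacunarySymmetroidMatrixDescartes.Range.card_roots_of_fullPos h

theorem filter_roots_of_fullPos {q : ℝ[X]} (h : IsFullPosRooted q) :
    q.roots.filter (0 < ·) = q.roots :=
  Theorems.LacunarySymmetroidMatrixDescartes.Range.filter_roots_of_fullPos h

theorem roots_pos_of_fullPos {q : ℝ[X]} (h : IsFullPosRooted q) : ∀ a ∈ q.roots, 0 < a :=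
  Theorems.LacunarySymmetroidMatrixDescartes.Range.roots_pos_of_fullPos h

theorem toFinset_card_roots_of_fullPos {q : ℝ[X]} (h : IsFullPosRooted q) :
    q.roots.toFinset.card = q.natDegree :=
  Theorems.LacunarySymmetroidMatrixDescartes.Range.toFinset_card_roots_of_fullPos h

/-! ## §2 Two multiset inequalities (PROVED — tree) -/

theorem abs_prod_map_sub {s : Multiset ℝ} (hs : ∀ a ∈ s, 0 < a) {t : ℝ} (ht : t ≤ 0) :
    |(s.map (fun a => t - a)).prod| = (s.map (fun a => a - t)).prod :=
  Theorems.LacunarySymmetroidMatrixDescartes.Range.abs_prod_map_sub hs ht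

/-- AM–GM letter by letter: `2^|s| · √(∏ s) ≤ ∏ (a + 1)` for a multiset of positive reals; equality iff all `a = 1`. -/
theorem two_pow_mul_sqrt_prod_le {s : Multiset ℝ} (hs : ∀ a ∈ s, 0 < a) :
    (2:ℝ) ^ Multiset.card s * Real.sqrt s.prod ≤ (s.map (fun a => a + 1)).prod :=
  Theorems.LacunarySymmetroidMatrixDescartes.Range.two_pow_mul_sqrt_prod_le hs

/-! ## §3 THE RANGE LAW for full-positive-rooted polynomials (PROVED — tree, elementary, sharp at `c·(X−1)^n`) -/

theorem eval_eq_of_fullPos {q : ℝ[X]} (h : IsFullPosRooted q) (t : ℝ) :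
    q.eval t = q.leadingCoeff * (q.roots.map (fun a => t - a)).prod :=
  Theorems.LacunarySymmetroidMatrixDescartes.Range.eval_eq_of_fullPos h t

/-- **Range law.** A real polynomial with `natDegree q` positive roots satisfies
`2^{deg q} · √|q(0)·lc(q)| ≤ |q(−1)|`. [folklore: AM–GM on `∏(1+ρᵢ)`] -/
theorem rangeLaw_fullPos (q : ℝ[X]) (h : IsFullPosRooted q) :
    (2:ℝ) ^ q.natDegree * Real.sqrt (|q.coeff 0 * q.leadingCoeff|) ≤ |q.eval (-1)| :=
  Theorems.LacunarySymmetroidMatrixDescartes.Range.rangeLaw_fullPos q h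

/-- The evaluation at `−1` is dominated by the `ℓ¹`-norm of the coefficients. [folklore] -/
theorem abs_eval_neg_one_le_sum (q : ℝ[X]) :
    |q.eval (-1)| ≤ ∑ r ∈ Finset.range (q.natDegree + 1), |q.coeff r| :=
  Theorems.LacunarySymmetroidMatrixDescartes.Range.abs_eval_neg_one_le_sum q

/-- Corollary: `2^{deg} · √|c₀ · c_n| ≤ ‖q‖₁` (coefficient DYNAMIC RANGE ≥ one bit per root). [folklore] -/
theorem rangeLaw_fullPos_l1 (q : ℝ[X]) (h : IsFullPosRooted q) :
    (2:ℝ) ^ q.natDegree * Real.sqrt (|q.coeff 0 * q.leadingCoeff|)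
      ≤ ∑ r ∈ Finset.range (q.natDegree + 1), |q.coeff r| :=
  Theorems.LacunarySymmetroidMatrixDescartes.Range.rangeLaw_fullPos_l1 q h

/-! ## §4 Pencils: evaluation and the determinant height bound (PROVED — tree) -/

theorem eval_det_pencil {m K : ℕ} (d : Fin K → ℕ) (S : Fin K → Matrix (Fin m) (Fin m) ℝ) (t : ℝ) :
    (pencil d S).det.eval t = (∑ l, t ^ d l • S l).det :=
  Theorems.LacunarySymmetroidMatrixDescartes.Range.eval_det_pencil d S t

theorem abs_det_sum_smul_le {m K : ℕ} (d : Fin K → ℕ) (S : Fin K → Matrix (Fin m) (Fin m) ℝ) {h : ℝ}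
    (hS : ∀ l i j, |S l i j| ≤ h) {t : ℝ} (ht : |t| ≤ 1) :
    |(∑ l, t ^ d l • S l).det| ≤ (m.factorial : ℝ) * (K * h) ^ m :=
  Theorems.LacunarySymmetroidMatrixDescartes.Range.abs_det_sum_smul_le d S hS ht

/-- **Height law for full-positive-rooted pencils** (any real letters bounded by `h`, any exponents):
`2^{deg det P} · √|c₀ · lc| ≤ |det P(−1)| ≤ m! · (K h)^m`. [folklore] -/
theorem heightLaw {m K : ℕ} (d : Fin K → ℕ) (S : Fin K → Matrix (Fin m) (Fin m) ℝ) {h : ℝ}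
    (hS : ∀ l i j, |S l i j| ≤ h) (hfull : IsFullPosRooted (pencil d S).det) :
    (2:ℝ) ^ (pencil d S).det.natDegree
        * Real.sqrt (|(pencil d S).det.coeff 0 * (pencil d S).det.leadingCoeff|)
      ≤ (m.factorial : ℝ) * (K * h) ^ m :=
  Theorems.LacunarySymmetroidMatrixDescartes.Range.heightLaw d S hS hfull

/-! ## §5 The height-`H` stamp row and its numeric instances (PROVED — tree; `HeightStampLawAt` is (D)'s) -/

/-- The height law decides the height-`H` stamp row: `m!·(K H)^m < 2^{B+1} ⇒ ν_H(m,K) ≤ B`. [folklore] -/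
theorem heightStampLawAt_of_lt {m K B : ℕ} {H : ℝ}
    (hB : (m.factorial : ℝ) * (K * H) ^ m < 2 ^ (B + 1)) : HeightStampLawAt m K H B :=
  Theorems.LacunarySymmetroidMatrixDescartes.Range.heightStampLawAt_of_lt hB

/-- `(2,5)`: no full `2×2` 5-term pencil of degree `12` (the located `ν(2,5) = n(2,4) = 12` format) has letters
bounded by `9` — integer realisations of the stamp number `12` need an entry `≥ 10`. -/
theorem heightStampLaw_2_5 : HeightStampLawAt 2 5 9 11 :=
  Theorems.LacunarySymmetroidMatrixDescartes.Range.heightStampLaw_2_5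

/-- `G6` at bounded height: no full `2×2` 6-term pencil of degree `16 = n(2,5)` with letters `≤ 30`. -/
theorem heightStampLaw_G6 : HeightStampLawAt 2 6 30 15 :=
  Theorems.LacunarySymmetroidMatrixDescartes.Range.heightStampLaw_G6

/-- `G7` at bounded height: degree `20 = n(2,6)` needs an entry `≥ 104`. -/
theorem heightStampLaw_G7 : HeightStampLawAt 2 7 103 19 :=
  Theorems.LacunarySymmetroidMatrixDescartes.Range.heightStampLaw_G7

/-- `G8` at bounded height (the divergence cell `(2,8)`): degree `26 = n(2,7)` needs an entry `≥ 725`; in particular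
«eleven-thirds at `K = 8`» survives every full integer pencil of height `≤ 724`. -/
theorem heightStampLaw_G8 : HeightStampLawAt 2 8 724 25 :=
  Theorems.LacunarySymmetroidMatrixDescartes.Range.heightStampLaw_G8

/-- `G9` at bounded height: degree `32 = n(2,8)` needs an entry `≥ 5149`. -/
theorem heightStampLaw_G9 : HeightStampLawAt 2 9 5148 31 :=
  Theorems.LacunarySymmetroidMatrixDescartes.Range.heightStampLaw_G9

/-! ## §6 Integer letters normalise themselves: `|c₀ · lc| ≥ 1` (PROVED — tree; `pencilZ` / `castZ` are (D)'s) -/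

theorem det_pencil_castZ {m K : ℕ} (d : Fin K → ℕ) (Z : Fin K → Matrix (Fin m) (Fin m) ℤ) :
    (pencil d (castZ Z)).det = Polynomial.map (Int.castRingHom ℝ) (pencilZ d Z).det :=
  Theorems.LacunarySymmetroidMatrixDescartes.Range.det_pencil_castZ d Z

theorem coeff_zero_ne_zero_of_fullPos {q : ℝ[X]} (hq : q ≠ 0) (hfull : IsFullPosRooted q) : q.coeff 0 ≠ 0 :=
  Theorems.LacunarySymmetroidMatrixDescartes.Range.coeff_zero_ne_zero_of_fullPos hq hfull

/-- For integer letters with non-degenerate full-positive-rooted determinant, `1 ≤ |c₀ · lc|`. [folklore] -/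
theorem one_le_abs_ends_of_int {m K : ℕ} (d : Fin K → ℕ) (Z : Fin K → Matrix (Fin m) (Fin m) ℤ)
    (hfull : IsFullPosRooted (pencil d (castZ Z)).det) (hq : (pencil d (castZ Z)).det ≠ 0) :
    1 ≤ |(pencil d (castZ Z)).det.coeff 0 * (pencil d (castZ Z)).det.leadingCoeff| :=
  Theorems.LacunarySymmetroidMatrixDescartes.Range.one_le_abs_ends_of_int d Z hfull hq

/-- **Integer corollary.** A height-`H` stamp row bounds the degree of every full-positive-rooted INTEGER pencil with
entries `≤ H`: e.g. with `heightStampLaw_G6`, no integer `2×2` 6-term pencil with entries in `[-30,30]` realises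
degree `16` (so `stub_G6`'s integer certificates have an entry `≥ 31`; `G8`: `≥ 725`; `G9`: `≥ 5149`). [folklore] -/
theorem natDegree_le_of_int {m K B : ℕ} {H : ℝ} (hlaw : HeightStampLawAt m K H B) (d : Fin K → ℕ)
    (Z : Fin K → Matrix (Fin m) (Fin m) ℤ) (hZ : ∀ l i j, |((Z l i j : ℤ) : ℝ)| ≤ H)
    (hfull : IsFullPosRooted (pencil d (castZ Z)).det) (hq : (pencil d (castZ Z)).det ≠ 0) :
    (pencil d (castZ Z)).det.natDegree ≤ B :=
  Theorems.LacunarySymmetroidMatrixDescartes.Range.natDegree_le_of_int hlaw d Z hZ hfull hq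

/-! ## §7 The rung «height-MDR» (OPEN, on-path; the def `HeightMatrixDescartes` is (D)'s) and its FULL SECTOR (PROVED — tree) -/

/-- The rung is ON-PATH: the crux implies it (drop the two extra hypotheses).  Kept LOCAL (the only declaration of the line
that needs the Theses import). [folklore] -/
theorem heightMDR_of_matrixDescartes (h : MatrixDescartes) : HeightMatrixDescartes := by
  intro c q hq
  obtain ⟨K₀, hK₀⟩ := h c q hq
  exact ⟨K₀, fun K m hK hm d S hS _ _ => hK₀ K m hK hm d S hS⟩

/-- Polylog bookkeeping: `3(L+c)^c + L + 1 ≤ (L+c+4)^(c+4)`. -/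
theorem poly_bound (L c : ℕ) : 3 * (L + c) ^ c + L + 1 ≤ (L + (c + 4)) ^ (c + 4) :=
  Theorems.LacunarySymmetroidMatrixDescartes.Range.poly_bound L c

/-- **The FULL SECTOR of the rung, PROVED** (elementary: range law + `Matrix.det_le` + `StubArith4.exp_le`):
in the crux's regime `m ≤ 2^{(⌊log₂K⌋+c)^c}`, every full-positive-rooted pencil with letters of height
`≤ 2^{(⌊log₂K⌋+c)^c}` and `|c₀·lc| ≥ 1` has `(#roots)^q ≤ 2^{K⌊log₂K⌋}` for `K ≥ K₀(c,q)`.  Symmetry is not used. -/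
theorem heightMDR_fullSector (c q : ℕ) : ∃ K₀ : ℕ, ∀ K m : ℕ, K₀ ≤ K → m ≤ 2 ^ ((Nat.log 2 K + c) ^ c) →
      ∀ (d : Fin K → ℕ) (S : Fin K → Matrix (Fin m) (Fin m) ℝ),
        (∀ l i j, |S l i j| ≤ (2:ℝ) ^ ((Nat.log 2 K + c) ^ c)) →
        1 ≤ |(pencil d S).det.coeff 0 * (pencil d S).det.leadingCoeff| →
        IsFullPosRooted (pencil d S).det →
        (pencil d S).det.roots.toFinset.card ^ q ≤ 2 ^ (K * Nat.log 2 K) :=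
  Theorems.LacunarySymmetroidMatrixDescartes.Range.heightMDR_fullSector c q

/-! ## §8 The rung reduces to its NON-FULL sector (PROVED split — tree; the def `HeightMDRNonFull` is (D)'s) -/

/-- **Composition (PROVED):** the non-full sector is all that is left of the rung. -/
theorem heightMDR_of_nonFull (h : HeightMDRNonFull) : HeightMatrixDescartes :=
  Theorems.LacunarySymmetroidMatrixDescartes.Range.heightMDR_of_nonFull h

/-! ## §9 «Assume the law fails»: structure of violators at bounded height (ONE typed obligation left + PROVED composition;
`l1` is (D)'s, `DetL1Bound` is discharged by `…RangeObligations.detL1Bound`, p607620) -/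

theorem abs_coeff_zero_le_l1 (q : ℝ[X]) : |q.coeff 0| ≤ l1 q :=
  Theorems.LacunarySymmetroidMatrixDescartes.RangeObligations.abs_coeff_zero_le_l1 q

/-- OBLIGATION «Erdős–Turán on the positive axis» (KNOWN THEOREM, not in tree; Erdős–Turán, Ann. Math. 51 (1950)
Thm 1 with the sector shrunk onto the positive real axis; constant `16² = 256`): the number of distinct positive roots
`Z₊` of a real polynomial with `a₀ ≠ 0` satisfies `Z₊² ≤ 256 · deg · log(‖q‖₁ / √|a₀ a_N|)`.  (Literature typer item of the
val-lit desk, RULING #233 (d); the consumer `…RangeObligations.violator_degree` takes exactly this text as its binder `hET`.) -/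
def ErdosTuranPositiveAxis : Prop :=
  ∀ q : ℝ[X], q.coeff 0 ≠ 0 →
    (((q.roots.filter (0 < ·)).toFinset.card : ℕ) : ℝ) ^ 2
      ≤ 256 * q.natDegree * Real.log (l1 q / Real.sqrt |q.coeff 0 * q.leadingCoeff|)

/-- **rev 3: the obligation follows from the NAMED Literature fact** `Literature.Algebra.Polynomial.ErdosTuran1950_positiveZeros`
(Erdős–Turán 1950 / Milovanović–Rassias 2000 Thm 5.1, typed by val-lit-p9 g0, p609585) through its proved bridge `.positiveAxis`
(`Literature/Algebra/Polynomial/ErdosTuranPositiveZerosProofs.lean`; same text with `l1` unfolded). -/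
theorem erdosTuranPositiveAxis_of (h : Literature.Algebra.Polynomial.ErdosTuran1950_positiveZeros) : ErdosTuranPositiveAxis :=
  h.positiveAxis

/-- OBLIGATION «`ℓ¹` height of a pencil determinant» (ROUTINE support): letters bounded by `h` give `‖det P‖₁ ≤ m!(Kh)^m`.
rev 2: DISCHARGED below (`detL1Bound`). -/
def DetL1Bound : Prop :=
  ∀ (m K : ℕ) (d : Fin K → ℕ) (S : Fin K → Matrix (Fin m) (Fin m) ℝ) (h : ℝ), (∀ l i j, |S l i j| ≤ h) →
    l1 (pencil d S).det ≤ (m.factorial : ℝ) * (K * h) ^ m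

/-- **`DetL1Bound` holds** (rev 2; tree: `…RangeObligations.detL1Bound`, p607620 — `‖det P‖₁ = Σ_r |a_r| ≤ m!·h^m·Σ_r R_d^{(m)}(r)
≤ m!·h^m·K^m` by the permutation expansion of line «profile» and a fibre count). [folklore] -/
theorem detL1Bound : DetL1Bound :=
  Theorems.LacunarySymmetroidMatrixDescartes.RangeObligations.detL1Bound

/-- **Violator structure (PROVED composition; rev 2: the hypothesis `hL1 : DetL1Bound` of rev 1 is discharged).**  Under
`ErdosTuranPositiveAxis`, a pencil with letters `≤ h` and `|c₀·lc| ≥ 1` has `Z₊² ≤ 256 · deg(det P) · log(m!(Kh)^m)`: at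
quasi-polynomial height a violator of the crux's rate (`Z₊ > 2^{K log K/q}`) is a DEGREE-INEFFICIENT monster,
`deg ≥ Z₊² / (256·log(m!(Kh)^m)) = 2^{Ω(K log K)}`, hence non-full by a doubly-exponential margin — the exact opposite of the
stamp/full formats of the census. -/
theorem violator_degree (hET : ErdosTuranPositiveAxis) {m K : ℕ} (d : Fin K → ℕ)
    (S : Fin K → Matrix (Fin m) (Fin m) ℝ) {h : ℝ} (hS : ∀ l i j, |S l i j| ≤ h)
    (hends : 1 ≤ |(pencil d S).det.coeff 0 * (pencil d S).det.leadingCoeff|) :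
    ((((pencil d S).det.roots.filter (0 < ·)).toFinset.card : ℕ) : ℝ) ^ 2
      ≤ 256 * (pencil d S).det.natDegree * Real.log ((m.factorial : ℝ) * (K * h) ^ m) :=
  Theorems.LacunarySymmetroidMatrixDescartes.RangeObligations.violator_degree hET d S hS hends

/-- Division form (rev 2, tree `…RangeObligations.violator_natDegree_ge`): with height budget `m!·(K h)^m > 1`,
`deg(det P) ≥ Z₊² / (256 · log(m!·(K h)^m))`. -/
theorem violator_natDegree_ge (hET : ErdosTuranPositiveAxis) {m K : ℕ} (d : Fin K → ℕ)
    (S : Fin K → Matrix (Fin m) (Fin m) ℝ) {h : ℝ} (hS : ∀ l i j, |S l i j| ≤ h)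
    (hends : 1 ≤ |(pencil d S).det.coeff 0 * (pencil d S).det.leadingCoeff|)
    (hbudget : 1 < (m.factorial : ℝ) * (K * h) ^ m) :
    ((((pencil d S).det.roots.filter (0 < ·)).toFinset.card : ℕ) : ℝ) ^ 2
        / (256 * Real.log ((m.factorial : ℝ) * (K * h) ^ m))
      ≤ (pencil d S).det.natDegree :=
  Theorems.LacunarySymmetroidMatrixDescartes.RangeObligations.violator_natDegree_ge hET d S hS hends hbudget

/-- **rev 3 composition over the NAMED fact**: Erdős–Turán 1950 (typed, `ErdosTuran1950_positiveZeros`) ⇒ the violator structure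
`Z₊² ≤ 256 · deg(det P) · log(m!(Kh)^m)` for every pencil with letters `≤ h` and `|c₀·lc| ≥ 1` — CONDITIONAL on that one published
fact only (Theorems side: `…RangeObligationsErdosTuran.violator_degree_of_erdosTuran1950`). -/
theorem violator_degree_of_erdosTuran1950 (h : Literature.Algebra.Polynomial.ErdosTuran1950_positiveZeros) {m K : ℕ}
    (d : Fin K → ℕ) (S : Fin K → Matrix (Fin m) (Fin m) ℝ) {h' : ℝ} (hS : ∀ l i j, |S l i j| ≤ h')
    (hends : 1 ≤ |(pencil d S).det.coeff 0 * (pencil d S).det.leadingCoeff|) :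
    ((((pencil d S).det.roots.filter (0 < ·)).toFinset.card : ℕ) : ℝ) ^ 2
      ≤ 256 * (pencil d S).det.natDegree * Real.log ((m.factorial : ℝ) * (K * h') ^ m) :=
  violator_degree (erdosTuranPositiveAxis_of h) d S hS hends

/-! ### rev 4 (val-port-1 g1, 2026-08-28): §9 UNCONDITIONAL — Erdős–Turán on the positive axis is a THEOREM of the tree
(`Literature.Algebra.Polynomial.ErdosTuran1950_positiveZeros_holds`, val-lit-p11 g1, p620775; Theorems side of this line:
`…RangeObligations.violator_degree_unconditional` / `violator_natDegree_ge_unconditional`, p623360).  After this revision the line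
«range» carries NO named-fact hypothesis: its only open content is the rung obligation `HeightMDRNonFull` (§8), which is crux-hard. -/

/-- **The obligation `ErdosTuranPositiveAxis` HOLDS** (rev 4): by name from the landed discharge of the Erdős–Turán fact. -/
theorem erdosTuranPositiveAxis_holds : ErdosTuranPositiveAxis :=
  erdosTuranPositiveAxis_of Literature.Algebra.Polynomial.ErdosTuran1950_positiveZeros_holds

/-- **Violator structure, UNCONDITIONAL** (rev 4): every pencil with letters `≤ h` and `|c₀·lc| ≥ 1` has
`Z₊² ≤ 256 · deg(det P) · log(m!(Kh)^m)` — no hypothesis left (tree: `…RangeObligations.violator_degree_unconditional`). -/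
theorem violator_degree_unconditional {m K : ℕ} (d : Fin K → ℕ) (S : Fin K → Matrix (Fin m) (Fin m) ℝ) {h : ℝ}
    (hS : ∀ l i j, |S l i j| ≤ h) (hends : 1 ≤ |(pencil d S).det.coeff 0 * (pencil d S).det.leadingCoeff|) :
    ((((pencil d S).det.roots.filter (0 < ·)).toFinset.card : ℕ) : ℝ) ^ 2
      ≤ 256 * (pencil d S).det.natDegree * Real.log ((m.factorial : ℝ) * (K * h) ^ m) :=
  violator_degree erdosTuranPositiveAxis_holds d S hS hends

/-- Division form, UNCONDITIONAL (rev 4; tree: `…RangeObligations.violator_natDegree_ge_unconditional`). -/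
theorem violator_natDegree_ge_unconditional {m K : ℕ} (d : Fin K → ℕ) (S : Fin K → Matrix (Fin m) (Fin m) ℝ) {h : ℝ}
    (hS : ∀ l i j, |S l i j| ≤ h) (hends : 1 ≤ |(pencil d S).det.coeff 0 * (pencil d S).det.leadingCoeff|)
    (hbudget : 1 < (m.factorial : ℝ) * (K * h) ^ m) :
    ((((pencil d S).det.roots.filter (0 < ·)).toFinset.card : ℕ) : ℝ) ^ 2
        / (256 * Real.log ((m.factorial : ℝ) * (K * h) ^ m))
      ≤ (pencil d S).det.natDegree :=
  violator_natDegree_ge erdosTuranPositiveAxis_holds d S hS hends hbudget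


end Summit.ValiantsHypothesis.ValiantsHypothesis.Theses.LacunarySymmetroid.RangeLine
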